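import Literature.MathematicalPhysics.QuantumFieldTheory.Federbush1986.PeelingLinearisation
import Literature.MathematicalPhysics.QuantumFieldTheory.Federbush1986.NiceSublatticePeeling
import Literature.MathematicalPhysics.QuantumFieldTheory.Federbush1986.RadialGaugePeeling
import Literature.MathematicalPhysics.QuantumFieldTheory.Federbush1986.PuncturedBlockPeeling

/-!
# Federbush [F3] §5.3 5) p. 304 «In this gauge we deduce an inequality like (5.24)» — the instances: (5.24) (`Eq524Le`) in the
# Bałaban axial (comb) gauge of every box, in the radial gauge about any base point, in the extended axial gauge of the punctured
# block, and IN THE AXIAL GAUGE OF THE NICE BLOCK SUBLATTICE of every family of balls of total size less than the block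

statement-level skeleton of published theorems with citation tags; proofs where landed; nothing here is a claim about the Yang–Mills mass gap

SOURCE. [Federbush1987PhaseCellIII] P. Federbush, *A phase cell approach to Yang–Mills theory III*, Commun. Math. Phys. **110** (1987)
293–309 (held `paper:url-4700a514f365`, pp. 302–304 = PDF pp. 10–12): §5.2 p. 302 «We now work in a Balaban axial gauge. … By the
inverse function theorem we have for A_{∂p_i} small enough (depending on N), |A_{b_α} − Σ_i N_{αi}A_{∂p_i}| < cΣ|A_{∂p_i}|². (5.24)»;
§5.3 p. 303–304 «1) We include the l.f. plaquettes (among the p_i) inside ≦ r₁ balls of radius ≦ c₂. … 2) … By removing ≦ c₄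
vertices and bonds each major block sublattice … may be made simply connected and connected. … 3) The bonds assigned ε inside a
block in the Balaban axial gauge will also be assigned ε in the nice block sublattice. … We assign ε to a sufficient number of
additional bonds to define an axial gauge in each nice block. 4) … we may in this section let B be the base point, instead of C.
This does not effect our estimate, it is a gauge change. … 5) 3), and 4) specify a gauge. In this gauge we deduce an inequality
like (5.24), with both sums over only s.f. plaquettes.»

CITATION HEADER (lean-in-tree rule).  lit-balaban cell (HOME `run/shared/lean/pub/lit-balaban/`), Phase-2 proof seat p26 (gen 15;
free-target protocol G.5-34(d), TAKING HOME/STATUS 2026-08-22T10:47Z), SKELETON rows **F3.Eq5.24** and **F3.Eq5.26-5.40** step 5)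
(owner r17, referee ref-5; no head change).  Companion of `PeelingLinearisation` (this seat, p327205: `Peeling.linearisation`,
`Peeling.eq524Le` — (5.22)–(5.24) for EVERY peeling and every group with §1's chart data `LocalLog G 𝔤`), applied to the peelings
this thread has constructed: `combPeeling` (p313427), `radialPeeling` (p320310), `nicePeeling` (p315721), and the nice block
sublattices `exists_peeling_of_sizeSum_lt` / `exists_niceSublattice_peeling` (p326242).  Nothing edited.

WHAT IS PROVED (every group `G` with a bi-invariant distance and chart data `L : LocalLog G 𝔤` — e.g. `SU2.localLog`, `UN.localLog`):
* `boxBonds_finite` (bookkeeping) and **`eq524Le_combGauge`** — (5.24) in the comb = Bałaban axial gauge of every box `[lo, hi]` of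
  `ℤ^d`, every `d` («We now work in a Balaban axial gauge», §5.2): p32's model instances `eq524Le_combStrip` / `eq524Le_combBlock`
  (`G = SU(2)`) re-derived for every `d`, every box and every `G`, from the general theorem.
* **`eq524Le_radialGauge`** — (5.24) in the radial tree gauge about ANY base point `B` of the box (step 4) «let B be the base
  point … it is a gauge change»).
* **`eq524Le_puncturedBlock`** — (5.24) in the extended axial gauge of the punctured block `[lo, hi] ∖ [klo, khi] ⊂ ℤ^{n+3}`
  (step 3) «We assign ε to a sufficient number of additional bonds to define an axial gauge in each nice block»).
* **`eq524Le_of_sizeSum_lt`** — for `d ≥ 3` and every pairwise-separated family of non-spanning boxes of the block of total size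
  less than the block in one direction: a spanning forest gauge `T` of the surviving lattice and a peeling in which (5.24) holds.
* **`eq524Le_niceSublattice`** — THE SENTENCE OF STEP 5) FOR BALLS ANYWHERE: for `d ≥ 3` and EVERY finite family of boxes of
  total size less than the block in every direction («≦ r₁ balls of radius ≦ c₂», `N` large), the coarsened nice block sublattice
  (steps 1)–2)) carries an axial gauge (step 3)) in which the bond variables satisfy (5.24) in the attached plaquette variables
  (step 5)), for every such `G`; `eq524Le_niceSublattice_SU2` for [F3]'s `SU(2)`.

HONEST SCOPE.  As in `PeelingLinearisation`: constants explicit but crude (exponential in the maximal rank of the peeling), depending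
on the lattice portion only («Some of the constants will depend on N»); configurations = the small-field region of the gauge-fixed
bond variables; the plaquette variables of the carrier are the attached ones (print's linearly independent `J`).  Step 4)'s
averages set to `ε` and the «both sums over only s.f. plaquettes» bookkeeping of the two-level scheme are p32's `Regime2*` files, not
touched here.  One `theorem`-only file (no definitions, no new named facts); no `sorry`, axioms standard.  Unit `lit-balaban-p26`
(literature-prover-lit-balaban-p26-g15-0).
-/

namespace Literature.MathematicalPhysics.QuantumFieldTheory.Federbush1986

noncomputable section

namespace PeelingObservation

open scoped BigOperators
open LatticeContour SimplyConnectedBox CombGaugeObservation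

variable {d : ℕ}

/-! ## §1 The comb (Bałaban axial) gauge of a box, every `d`, every `G` -/

/-- A box has finitely many bonds. [cite: Federbush1987PhaseCellIII, §5.2 p. 302] -/
theorem boxBonds_finite (lo hi : LatticeContour.Site d) : (boxBonds lo hi).Finite :=
  ((boxSites_finite lo hi).prod Set.finite_univ).subset fun _ hb => ⟨hb.1, Set.mem_univ _⟩

/-- The non-comb bonds of a box are finitely many. [cite: Federbush1987PhaseCellIII, §5.2 p. 302] -/
theorem boxBonds_diff_combTree_finite (lo hi : LatticeContour.Site d) : (boxBonds lo hi \ combTree lo hi).Finite :=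
  (boxBonds_finite lo hi).subset Set.sdiff_subset

section Groups

-- the carrier `AxialGaugeLinearisation` (r17) lives in `Type`
variable {G : Type} [Group G] [MetricSpace G] [IsIsometricSMul G G] [IsIsometricSMul Gᵐᵒᵖ G]
variable {𝔤 : Type} [NormedAddCommGroup 𝔤] [NormedSpace ℝ 𝔤] (L : LocalLog G 𝔤)

/-- **(5.24) in the Bałaban axial (comb) gauge of every box of `ℤ^d`**, every `d`, every group with §1's chart data («We now work in a
Balaban axial gauge. … By the inverse function theorem we have for A_{∂p_i} small enough (depending on N),
|A_{b_α} − Σ_i N_{αi}A_{∂p_i}| ≦ cΣ|A_{∂p_i}|² (5.24)»): p32's `SU(2)` strip/block model instances in general form.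
[cite: Federbush1987PhaseCellIII, (5.24) p. 302; §5.3 3) p. 303] -/
theorem eq524Le_combGauge (lo hi : LatticeContour.Site d) :
    ((combPeeling lo hi).linearisation L (boxBonds_diff_combTree_finite lo hi)).Eq524Le :=
  (combPeeling lo hi).eq524Le L _

/-- The same for [F3]'s `G = SU(2)`. [cite: Federbush1987PhaseCellIII, (5.24) p. 302; §1 p. 294] -/
theorem eq524Le_combGauge_SU2 (lo hi : LatticeContour.Site d) :
    ((combPeeling lo hi).linearisation SU2.localLog (boxBonds_diff_combTree_finite lo hi)).Eq524Le :=
  eq524Le_combGauge SU2.localLog lo hi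

/-! ## §2 The radial gauge about any base point (step 4)) -/

/-- **(5.24) in the radial tree gauge of a box about ANY base point `B ∈ [lo, hi]`** (radial contours of the lattice parent map `Lr`,
p25/p32's `RadialTree.LatticeParentMap`; step 4) «we may in this section let B be the base point, instead of C. This does not effect
our estimate, it is a gauge change»). [cite: Federbush1987PhaseCellIII, §5.3 4)–5) pp. 303–304; (5.24) p. 302] -/
theorem eq524Le_radialGauge (Lr : RadialTree.LatticeParentMap d) {B lo hi : LatticeContour.Site d} (hB : B ∈ boxSites lo hi) :
    ((RadialGaugePeeling.radialPeeling (L := Lr) hB).linearisation L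
      ((boxBonds_finite lo hi).subset Set.sdiff_subset)).Eq524Le :=
  (RadialGaugePeeling.radialPeeling hB).eq524Le L _

/-! ## §3 The punctured block (step 3), one ball) -/

/-- **(5.24) in the extended axial gauge `niceTree` of the punctured block `[lo, hi] ∖ [klo, khi] ⊂ ℤ^{n+3}`** (the removed box in the
interior; p26 g11's `nicePeeling`). [cite: Federbush1987PhaseCellIII, §5.3 3), 5) pp. 303–304; (5.24) p. 302] -/
theorem eq524Le_puncturedBlock {n : ℕ} {lo hi klo khi : LatticeContour.Site (n + 3)}
    (hK : ∀ i, lo i < klo i ∧ klo i ≤ khi i ∧ khi i < hi i) :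
    ((PuncturedBlockPeeling.nicePeeling hK).linearisation L
      ((SimplyConnectedBoxMinusBoxes.survBonds_finite lo hi (boxSites klo khi)).subset Set.sdiff_subset)).Eq524Le :=
  (PuncturedBlockPeeling.nicePeeling hK).eq524Le L _

/-! ## §4 The nice block sublattice of several balls (steps 1)–3), 5)) -/

open NiceSublatticePeeling SimplyConnectedBoxMinusBoundaryBoxes SimplyConnectedBoxMinusBoxes MajorSublattice
  SimplyConnectedGuillotine ObservationCriterion in
/-- **(5.24) on the nice block sublattice of a separated family of balls**: for `d ≥ 3` and every pairwise-separated family `H` of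
boxes of the block, each non-spanning, of total size less than the block in some direction `j`, the surviving lattice carries a
spanning forest gauge `T` and a peeling `π` such that the gauge-fixed bond variables satisfy (5.24) in the attached plaquette
variables, for every group with §1's chart data. [cite: Federbush1987PhaseCellIII, §5.3 1)–3), 5) pp. 303–304; (5.24) p. 302] -/
theorem eq524Le_of_sizeSum_lt (hd : 3 ≤ d) {lo hi : LatticeContour.Site d} {H : List (LatticeContour.Site d × LatticeContour.Site d)}
    {j : Fin d} (hH : ∀ h ∈ H, ∀ i, lo i ≤ h.1 i ∧ h.1 i ≤ h.2 i ∧ h.2 i ≤ hi i) (hsmall : sizeSum j H < hi j - lo j + 1)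
    (hns : ∀ h ∈ H, ∀ i, lo i < h.1 i ∨ h.2 i < hi i)
    (hsep : H.Pairwise (fun h h' => ∃ i, h'.2 i + 1 < h.1 i ∨ h.2 i + 1 < h'.1 i)) :
    ∃ (T : Set (Bond d)) (x₀ : LatticeContour.Site d)
      (π : Peeling (survPlaq lo hi (boxUnion H)) (survBonds lo hi (boxUnion H)) T)
      (hF : (survBonds lo hi (boxUnion H) \ T).Finite),
      T ⊆ survBonds lo hi (boxUnion H) ∧ IsForest T ∧ Spans T (survBonds lo hi (boxUnion H)) x₀ ∧
        (π.linearisation L hF).Eq524Le := by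
  obtain ⟨T, x₀, hTΛ, hfor, hsp, ⟨π⟩⟩ := exists_peeling_of_sizeSum_lt hd hH hsmall hns hsep
  exact ⟨T, x₀, π, (survBonds_finite lo hi _).subset Set.sdiff_subset, hTΛ, hfor, hsp, π.eq524Le L _⟩

open NiceSublatticePeeling SimplyConnectedBoxMinusBoundaryBoxes SimplyConnectedBoxMinusBoxes MajorSublattice
  SimplyConnectedGuillotine ObservationCriterion in
/-- **STEP 5) FOR BALLS ANYWHERE IN THE BLOCK: «3), and 4) specify a gauge. In this gauge we deduce an inequality like (5.24)».**  For
`d ≥ 3` and EVERY finite family `H` of boxes of the block `[lo, hi] ⊂ ℤ^d` whose sizes sum to less than the size of the block in every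
direction («≦ r₁ balls of radius ≦ c₂», `N` large) there are: a coarser family `H′` (at most as many boxes, containing the given ones,
total sizes not larger — steps 1)–2) «removing ≦ c₄ vertices and bonds»), a spanning forest gauge `T` of its surviving lattice (step 3)
«an axial gauge in each nice block») and a peeling `π`, such that for every group with §1's chart data the gauge-fixed bond variables
satisfy (5.24) (`Eq524Le`, the decl of record of row F3.Eq5.24) in the attached plaquette variables.
[cite: Federbush1987PhaseCellIII, §5.3 1)–3), 5) pp. 303–304; (5.24) p. 302] -/
theorem eq524Le_niceSublattice (hd : 3 ≤ d) {lo hi : LatticeContour.Site d} (H : List (LatticeContour.Site d × LatticeContour.Site d))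
    (hin : ∀ h ∈ H, ∀ i, lo i ≤ h.1 i ∧ h.1 i ≤ h.2 i ∧ h.2 i ≤ hi i) (hsmall : ∀ i, sizeSum i H < hi i - lo i + 1) :
    ∃ H' : List (LatticeContour.Site d × LatticeContour.Site d),
      boxUnion H ⊆ boxUnion H' ∧ H'.length ≤ H.length ∧ (∀ i, sizeSum i H' ≤ sizeSum i H) ∧
      survBonds lo hi (boxUnion H') ⊆ survBonds lo hi (boxUnion H) ∧
      ∃ (T : Set (Bond d)) (x₀ : LatticeContour.Site d)
        (π : Peeling (survPlaq lo hi (boxUnion H')) (survBonds lo hi (boxUnion H')) T)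
        (hF : (survBonds lo hi (boxUnion H') \ T).Finite),
        T ⊆ survBonds lo hi (boxUnion H') ∧ IsForest T ∧ Spans T (survBonds lo hi (boxUnion H')) x₀ ∧
          (π.linearisation L hF).Eq524Le := by
  obtain ⟨H', h1, h2, -, -, -, h5, h6, -, T, x₀, hTΛ, hfor, hsp, ⟨π⟩⟩ := exists_niceSublattice_peeling hd H hin hsmall
  exact ⟨H', h1, h2, h5, h6, T, x₀, π, (survBonds_finite lo hi _).subset Set.sdiff_subset, hTΛ, hfor, hsp, π.eq524Le L _⟩

end Groups

open NiceSublatticePeeling SimplyConnectedBoxMinusBoundaryBoxes SimplyConnectedBoxMinusBoxes MajorSublattice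
  SimplyConnectedGuillotine ObservationCriterion in
/-- … in particular for [F3]'s own `G = SU(2)` (`ρ = 1/4`, `K = 2`). [cite: Federbush1987PhaseCellIII, §5.3 5) p. 304; (5.24) p. 302;
§1 p. 294–295] -/
theorem eq524Le_niceSublattice_SU2 (hd : 3 ≤ d) {lo hi : LatticeContour.Site d}
    (H : List (LatticeContour.Site d × LatticeContour.Site d))
    (hin : ∀ h ∈ H, ∀ i, lo i ≤ h.1 i ∧ h.1 i ≤ h.2 i ∧ h.2 i ≤ hi i) (hsmall : ∀ i, sizeSum i H < hi i - lo i + 1) :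
    ∃ H' : List (LatticeContour.Site d × LatticeContour.Site d),
      boxUnion H ⊆ boxUnion H' ∧ H'.length ≤ H.length ∧ (∀ i, sizeSum i H' ≤ sizeSum i H) ∧
      survBonds lo hi (boxUnion H') ⊆ survBonds lo hi (boxUnion H) ∧
      ∃ (T : Set (Bond d)) (x₀ : LatticeContour.Site d)
        (π : Peeling (survPlaq lo hi (boxUnion H')) (survBonds lo hi (boxUnion H')) T)
        (hF : (survBonds lo hi (boxUnion H') \ T).Finite),
        T ⊆ survBonds lo hi (boxUnion H') ∧ IsForest T ∧ Spans T (survBonds lo hi (boxUnion H')) x₀ ∧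
          (π.linearisation SU2.localLog hF).Eq524Le :=
  eq524Le_niceSublattice SU2.localLog hd H hin hsmall

end PeelingObservation

end

end Literature.MathematicalPhysics.QuantumFieldTheory.Federbush1986
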